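import Literature.NumberTheory.EllipticCurves.BDPAnticyclotomicPAdicLFunction
import HarnessLib

/-!
# Castella–Hsieh 2018, Def. 3.7 + Prop. 3.8: the BDP anticyclotomic `p`-adic `L`-function EXISTS
# at a prime `p ∤ N` of GOOD reduction split in `K` — no hypothesis on the residual representation

F. Castella, M.-L. Hsieh, *Heegner cycles and p-adic L-functions*, Math. Ann. **370** (2018)
567–628 (arXiv:1505.08165), §3.3: for a newform `f ∈ S_{2r}^{new}(Γ₀(N))`, an odd prime `p ∤ N`
split in the imaginary quadratic field `K`, and the Heegner hypothesis, Definition 3.7 constructs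
the `p`-adic `L`-function `𝓛_{𝔭,ψ}(f) ∈ 𝒲⟦Γ̃⟧` (Serre–Tate expansion of the `p`-depleted form at CM
points; `𝒲` = Witt vectors of `𝔽̄_p`, `Γ̃ = Gal(K_{p^∞}/K)` whose maximal free quotient is the
anticyclotomic `Γ`) and Proposition 3.8 proves its interpolation formula at characters of infinity
type `(m, −m)`, `m ≥ 0`, with the Euler-type factor `e_𝔭(f, χ) = (1 − a_p(f) p^{−r} χ_𝔭̄(p) +
χ_𝔭̄(p²) p^{−1})²`. Running hypotheses of §3.3 (p. 10): "(Heeg′) `N_f⁻` is a square-free product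
of primes ramified in `K`" and "(ST)", both of which "will automatically hold" under the classical
Heegner hypothesis "(Heeg) `N` is a product of primes split in `K`" (§4.1, p. 12, verbatim); "Fix
an odd prime `p ∤ N`" (p. 3); `p = 𝔭𝔭̄` split. NO hypothesis on `ρ̄_{f,p}` (the arithmetic
Hypothesis (H) of the paper governs §§4–7 only, not the analytic §3). PUBLISHED / REFEREED.

This file states, as a named fact in the currency of the tree's characterising predicate
`IsBDPLFunction ι 𝔭 κ γ f Ω_K Ω_p L` (Castella 2018 Thm. 3.1's normalisation, `L ∈ R₀⟦T⟧`,
`BDPAnticyclotomicPAdicLFunction.lean`), the weight-2 / elliptic-curve case at a GOOD prime: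
the SIBLING of the registered fact `castella2018_exists_isBDPLFunction` (Castella 2018 Thm. 3.1:
`p ≥ 5`, `E` semistable, `ρ̄_{E,p}` irreducible, `p ∣ N` allowed) with Castella–Hsieh's hypotheses
instead — `p` odd, `p ∤ N` (good reduction), `p` split in `K`, (Heeg) for `N`, NO image
hypothesis. As the module docstring of `BDPAnticyclotomicPAdicLFunction.lean` records ("SCOPE: for
`p ∤ N` this is Castella–Hsieh 2018, Def. 3.5 + Prop. 3.6 (reformulated, `Tw_{ψ⁻¹}`)" — arXiv-v1
numbering there; = Def. 3.7 + Prop. 3.8 of the journal), Castella 2018 Thm. 3.1 at `p ∤ N` IS this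
construction, read through the twist by the auxiliary character and
the passage `Γ̃ ↠ Γ`, with the CM periods quantified existentially — so the statement below is a
CONSEQUENCE of the printed one exactly as its sibling is. Consumer: class X1 of the residual
programme (cell `bsd-eis`, `Summits/…/Rank1Residual/X1/KellerYinIMC2Halves.lean`: the existence
input H1 `GoodBDPExistsOnTree` of Keller–Yin Thm. 3.0.8 at the good lattice, where the sibling's
irreducibility hypothesis fails by definition of the class).

* `castellaHsieh2018_exists_isBDPLFunction` — the named fact (ONE `def … : Prop`; nothing asserted
  beyond the citation).

References: [CastellaHsieh2018] Def. 3.7, Prop. 3.8, §3.3 (Heeg′)/(ST), §4.1 (Heeg) — NUMBERING of the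
journal = arXiv v2 (7 Jan 2017); the arXiv v1 text (2015, the store's `paper:arxiv-1505.08165`, whose
pages are quoted above) numbers the same two items Def. 3.5 / Prop. 3.6 (pp. 10–12), while in the
journal numbering "Def. 3.5 / Prop. 3.6" are the `χ`-toric period and the explicit Waldspurger
formula (cf. Castella–Grossi–Lee–Skinner, Invent. Math. 227 (2022), proof of Thm. 2.1.1: "by
[cas-hsieh1, Prop. 3.8]"); [Castella2018] Thm. 3.1 and its proof ("the construction in
[cas-hsieh1] readily extends…", arXiv:1704.06608 p. 9); [BertoliniDarmonPrasanna2013] §5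
(the original construction); [CastellaGrossiLeeSkinner2022] Thm. 2.1.1 (the same object `𝓛_E` at
an Eisenstein prime, "`p = v v̄` splits in `K`", no image hypothesis).
-/

noncomputable section

open scoped Classical

open NumberField IsDedekindDomain Field Literature.NumberTheory.EllipticCurves.ModularForms

universe u

namespace Literature.NumberTheory.EllipticCurves

/-- **Castella–Hsieh 2018, Definition 3.7 + Proposition 3.8 (existence of the BDP anticyclotomic
`p`-adic `L`-function with its interpolation property at a GOOD ordinary-or-not prime `p` split in
`K`)** — named fact, weight 2, in the currency of `IsBDPLFunction` (Castella 2018 Thm. 3.1's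
normalisation; for `p ∤ N` that theorem IS Castella–Hsieh's construction, reformulated through
`Tw_{ψ⁻¹}` and `Γ̃ ↠ Γ`, periods quantified existentially — module docstring). Hypotheses, as
printed in Castella–Hsieh §3.3/§4.1: `f` the newform of the elliptic curve `W/ℚ` at level `N`
(`IsNewformOf W f`), `p` an ODD prime with `p ∤ N` ("Fix an odd prime `p ∤ N`", p. 3), `K`
imaginary quadratic with `p = 𝔭𝔭̄` SPLIT, the classical Heegner hypothesis (Heeg) "`N` is a product
of primes split in `K`" (§4.1 p. 12: "Thus (Heeg′) and (ST) will automatically hold"), `𝔭` the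
prime above `p` singled out by the embedding datum `ι : ℚ̄_p ≃ ℂ` (the compatibility clause of
`castella2018_exists_isBDPLFunction`, verbatim), `κ` THE anticyclotomic `ℤ_p`-extension and `γ` a
topological generator. Conclusion: CM periods `Ω_K ∈ ℂ^×`, `Ω_p ∈ R₀^×` and `L ∈ R₀⟦T⟧` with
`IsBDPLFunction ι 𝔭 κ γ f Ω_K Ω_p L`. NO hypothesis on `ρ̄_{E,p}` (reducible allowed), NO `p ≥ 5`,
NO square-freeness of `N` — the three restrictions of the sibling fact come from Castella 2018 §2.1,
not from the construction. PUBLISHED (Math. Ann. 370 (2018)).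
[cite: CastellaHsieh2018, Def. 3.7 and Prop. 3.8 (journal = arXiv v2 numbering; = arXiv v1 Def. 3.5 / Prop. 3.6, pp. 10–12) with §3.3 (Heeg′), (ST) and §4.1 (Heeg)]
[cite: Castella2018, Thm. 3.1 and proof (arXiv:1704.06608 p. 9), the normalisation `IsBDPLFunction`] -/
def castellaHsieh2018_exists_isBDPLFunction : Prop :=
  ∀ {p : ℕ} [Fact p.Prime] (ι : PadicAlgCl p ≃+* ℂ) (W : WeierstrassCurve ℚ) [W.IsElliptic]
    (K : Type) [Field K] [NumberField K] (𝔭 : HeightOneSpectrum (𝓞 K)) (κ : ZpExtension K p)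
    (γ : absoluteGaloisGroup K) {N : ℕ} [NeZero N] {f : CuspForm (CongruenceSubgroup.Gamma0 N) 2}
    (_ : IsNewformOf W f),
    p ≠ 2 → ¬ p ∣ N →
    IsImaginaryQuadratic K → ((Ideal.span {(p : ℤ)}).primesOver (𝓞 K)).ncard = 2 →
    ((p : ℕ) : 𝓞 K) ∈ 𝔭.asIdeal →
    (∀ (w : InfinitePlace K) (k : 𝓞 K),
      k ∈ 𝔭.asIdeal ↔ ‖ι.symm (w.embedding (k : K))‖ < 1) →
    SatisfiesHeegnerHypothesis N K →
    κ.IsAnticyclotomic → κ.IsTopGenerator γ →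
    ∃ (ΩK : ℂ) (Ωp : (unrIntegers p)ˣ) (L : UnrSeries p),
      ΩK ≠ 0 ∧ IsBDPLFunction ι 𝔭 κ γ f ΩK ((Ωp : unrIntegers p) : ℂ_[p]) L

end Literature.NumberTheory.EllipticCurves

end
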